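import Mathlib
import HarnessLib
import Literature.Analysis.FunctionSpaces.WeakCompactnessL1Proofs
import Literature.NumberTheory.Sieve.MatomakiRadziwillLemma4Lipschitz

/-!
# McLeish's product for bounded martingale differences: the factor `e^{ix}/(1+ix)`, its logarithmic expansion, and `E Π_{t<n}(1 + i a D_t) = 1` for increments orthogonal to their past

HONEST FRAMING: exact (Metropolis-corrected) sampling algorithms for lattice gauge theory;
figures of merit are autocorrelation/cost numbers at stated couplings and volumes; no
continuum-physics claim.

Venture `LatticeQCDFlow` (cell pub-lqcd), topic `Exactness`; FANOUT row 13 (`eng-snf`, GEN-19).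
NEW WORK of the cell (elementary complex analysis over Mathlib's `Complex.log` bounds
`Complex.norm_log_sub_logTaylor_le`, and Bochner-integral bookkeeping), not a published result of
ours; no definition is introduced; nothing is cited as a fact — the device is McLeish's (D. L.
McLeish, *Dependent central limit theorems and invariance principles*, Ann. Probab. 2 (1974),
Thm 2.3; Hall–Heyde 1980, Thm 3.2), NAMED ONLY.  Three elementary tree lemmas are REUSED by import
(`1 ≤ ‖1 + iy‖ ≤ 1 + |y|` from `Literature/NumberTheory/Sieve/MatomakiRadziwillLemma4Lipschitz.lean`, the
two-sided truncation `max_neg_min_eq_self` from `Literature/Analysis/FunctionSpaces/WeakCompactnessL1Proofs.lean`).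
Groundwork for the martingale central limit theorem
of `NCMCGeneralSpaceMartingaleCLT.lean` and, through it, the Markov-chain CLT under a Doeblin POWER
(`NCMCGeneralSpaceDoeblinPowerCLT.lean`) that gives the engine's NCMC lane (`run_ncmc_chain`, whose
iteration kernel is only two-step minorised — GEN-18) CLT-width error bars.

## Content

§1 the McLeish factor `q(x) = e^{ix}/(1 + ix)` (`x` real): `norm_one_add_mul_I` (`‖1 + ix‖ = √(1+x²)`),
`norm_one_add_mul_I_le_exp` (`≤ e^{x²/2}`), `norm_exp_div_one_add_mul_I_le` (`‖q(x)‖ ≤ 1`),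
`exp_div_one_add_mul_I_eq` (`q(x) = exp(ix − log(1+ix))`), `logTaylor_three_mul_I`,
**`norm_log_one_add_mul_I_sub_le`** (`‖log(1+ix) − (ix + x²/2)‖ ≤ (2/3)|x|³` for `|x| ≤ 1/2`);
products: **`prod_exp_div_eq_exp`** (`Π_{t<n} q(x_t) = exp(−½ Σ x_t² − Σ_t ρ(x_t))`,
`ρ(x) = log(1+ix) − ix − x²/2`), `norm_sum_rho_le` (`‖Σρ‖ ≤ (2/3)Σ|x_t|³`),
`norm_prod_exp_div_le_one`, `norm_prod_one_add_mul_I_le_exp` (`‖Π_t (1 + ix_t)‖ ≤ e^{½Σx_t²}`).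

§2 (`P` a probability measure, `D : ℕ → Ω → ℝ` measurable with `|D_t| ≤ C`, and the ORTHOGONALITY
hypothesis `∫ F(D_0,…,D_{n−1}) · D_n dP = 0` for every `n` and every bounded measurable
`F : (Fin n → ℝ) → ℝ` — the `D_t` are martingale differences for their own filtration; a
martingale-difference property for any larger filtration implies it):
`measurable_prod_one_add_mul_I`, `norm_prod_one_add_mul_I_le_pow` (`‖Π_{t<n}(1 + iaD_t)‖ ≤ (1+|a||C|)ⁿ`),
`abs_clip_le`; **`integral_prod_one_add_mul_I_mul_eq_zero`**
(`E[Π_{t<n}(1 + iaD_t) · D_n] = 0`: the real and imaginary parts of the product, CLIPPED at `C` so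
that the test function is bounded on all of `ℝⁿ`, are bounded measurable functions of the past);
**`integral_prod_one_add_mul_I_eq_one`** (`E Π_{t<n}(1 + iaD_t) = 1`, by induction).

NOT CLAIMED: anything about unbounded increments.
-/

namespace Summit.Ventures.LatticeQCDFlow.Exactness.GeneralNCMC

open MeasureTheory ProbabilityTheory Filter Finset Complex
open Literature.NumberTheory.Sieve.MatomakiRadziwillL4A (one_le_norm_one_add_mul_I norm_one_add_mul_I_le)
open Literature.Analysis.FunctionSpaces (max_neg_min_eq_self)
open scoped Topology Real
/-! ## §1 The McLeish factor `e^{ix} / (1 + ix)` -/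

section Factor

/-- `‖1 + x i‖ = √(1 + x²)`. -/
theorem norm_one_add_mul_I (x : ℝ) : ‖(1 : ℂ) + x * I‖ = Real.sqrt (1 + x ^ 2) := by
  simpa using Complex.norm_add_mul_I 1 x

/-- `‖1 + x i‖ ≤ exp(x²/2)` (from `1 + x² ≤ e^{x²}`). -/
theorem norm_one_add_mul_I_le_exp (x : ℝ) : ‖(1 : ℂ) + x * I‖ ≤ Real.exp (x ^ 2 / 2) := by
  rw [norm_one_add_mul_I, Real.exp_half]
  refine Real.sqrt_le_sqrt ?_
  have := Real.add_one_le_exp (x ^ 2)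
  linarith

/-- `‖e^{ix} / (1 + ix)‖ ≤ 1`. -/
theorem norm_exp_div_one_add_mul_I_le (x : ℝ) :
    ‖Complex.exp (x * I) / (1 + x * I)‖ ≤ 1 := by
  rw [norm_div, Complex.norm_exp_ofReal_mul_I]
  exact div_le_one_of_le₀ (one_le_norm_one_add_mul_I x) (norm_nonneg _)

/-- `e^{ix} / (1 + ix) = exp(ix − log(1 + ix))`. -/
theorem exp_div_one_add_mul_I_eq (x : ℝ) :
    Complex.exp (x * I) / (1 + x * I) = Complex.exp (x * I - Complex.log (1 + x * I)) := by
  have hne : (1 : ℂ) + x * I ≠ 0 := fun h => by simpa using congrArg Complex.re h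
  rw [Complex.exp_sub, Complex.exp_log hne]

/-- The third Taylor polynomial of `log (1 + ·)` at `x i` is `x i + x²/2`. -/
theorem logTaylor_three_mul_I (x : ℝ) :
    Complex.logTaylor 3 ((x : ℂ) * I) = x * I + (x : ℂ) ^ 2 / 2 := by
  simp only [Complex.logTaylor, Finset.sum_range_succ, Finset.sum_range_zero, pow_zero, pow_one,
    Nat.cast_zero, div_zero, Nat.cast_one, div_one, zero_add, Nat.cast_ofNat]
  rw [mul_pow, I_sq]
  norm_num

/-- **`‖log(1 + x i) − (x i + x²/2)‖ ≤ (2/3)|x|³` for `|x| ≤ 1/2`.** -/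
theorem norm_log_one_add_mul_I_sub_le {x : ℝ} (hx : |x| ≤ 1 / 2) :
    ‖Complex.log (1 + x * I) - (x * I + (x : ℂ) ^ 2 / 2)‖ ≤ 2 / 3 * |x| ^ 3 := by
  have hz : ‖(x : ℂ) * I‖ = |x| := by simp
  have hz1 : ‖(x : ℂ) * I‖ < 1 := by rw [hz]; linarith
  have h := Complex.norm_log_sub_logTaylor_le 2 hz1
  rw [logTaylor_three_mul_I, hz] at h
  have h2 : (1 - |x|)⁻¹ ≤ 2 := by
    rw [inv_le_comm₀ (by linarith) (by norm_num)]
    linarith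
  calc ‖Complex.log (1 + x * I) - (x * I + (x : ℂ) ^ 2 / 2)‖
      ≤ |x| ^ (2 + 1) * (1 - |x|)⁻¹ / (2 + 1) := h
    _ ≤ |x| ^ 3 * 2 / 3 := by
        norm_num
        exact div_le_div_of_nonneg_right
          (mul_le_mul_of_nonneg_left h2 (pow_nonneg (abs_nonneg x) 3)) (by norm_num)
    _ = 2 / 3 * |x| ^ 3 := by ring

/-- **The product of McLeish factors**: for real `x_t`,
`Π_{t<n} e^{ix_t}/(1 + ix_t) = exp(−½ Σ_{t<n} x_t² − Σ_{t<n} (log(1 + ix_t) − ix_t − x_t²/2))`. -/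
theorem prod_exp_div_eq_exp (x : ℕ → ℝ) (n : ℕ) :
    ∏ t ∈ range n, Complex.exp (x t * I) / (1 + x t * I)
      = Complex.exp (-(((∑ t ∈ range n, x t ^ 2 : ℝ) : ℂ) / 2)
          - ∑ t ∈ range n, (Complex.log (1 + x t * I) - (x t * I + (x t : ℂ) ^ 2 / 2))) := by
  have hterm : ∀ t, (x t : ℂ) * I - Complex.log (1 + x t * I)
      = -((x t : ℂ) ^ 2 / 2) - (Complex.log (1 + x t * I) - (x t * I + (x t : ℂ) ^ 2 / 2)) := by
    intro t; ring
  calc ∏ t ∈ range n, Complex.exp (x t * I) / (1 + x t * I)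
      = ∏ t ∈ range n, Complex.exp (x t * I - Complex.log (1 + x t * I)) :=
        Finset.prod_congr rfl fun t _ => exp_div_one_add_mul_I_eq (x t)
    _ = Complex.exp (∑ t ∈ range n, ((x t : ℂ) * I - Complex.log (1 + x t * I))) :=
        (Complex.exp_sum _ _).symm
    _ = _ := by
        congr 1
        simp_rw [hterm, Finset.sum_sub_distrib, Finset.sum_neg_distrib, ← Finset.sum_div]
        push_cast
        ring

/-- The remainder of the product: `‖Σ_{t<n} ρ(x_t)‖ ≤ (2/3) Σ_{t<n} |x_t|³` when every `|x_t| ≤ 1/2`. -/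
theorem norm_sum_rho_le (x : ℕ → ℝ) (n : ℕ) (hx : ∀ t ∈ range n, |x t| ≤ 1 / 2) :
    ‖∑ t ∈ range n, (Complex.log (1 + x t * I) - (x t * I + (x t : ℂ) ^ 2 / 2))‖
      ≤ 2 / 3 * ∑ t ∈ range n, |x t| ^ 3 := by
  rw [Finset.mul_sum]
  exact (norm_sum_le _ _).trans (Finset.sum_le_sum fun t ht => norm_log_one_add_mul_I_sub_le (hx t ht))

/-- `‖Π_{t<n} e^{ix_t}/(1 + ix_t)‖ ≤ 1`. -/
theorem norm_prod_exp_div_le_one (x : ℕ → ℝ) (n : ℕ) :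
    ‖∏ t ∈ range n, Complex.exp (x t * I) / (1 + x t * I)‖ ≤ 1 := by
  rw [norm_prod]
  exact Finset.prod_le_one (fun t _ => norm_nonneg _) fun t _ => norm_exp_div_one_add_mul_I_le (x t)

/-- `‖Π_{t<n} (1 + ix_t)‖ ≤ exp(½ Σ_{t<n} x_t²)`. -/
theorem norm_prod_one_add_mul_I_le_exp (x : ℕ → ℝ) (n : ℕ) :
    ‖∏ t ∈ range n, ((1 : ℂ) + x t * I)‖ ≤ Real.exp ((∑ t ∈ range n, x t ^ 2) / 2) := by
  rw [norm_prod, Finset.sum_div, Real.exp_sum]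
  exact Finset.prod_le_prod (fun t _ => norm_nonneg _) fun t _ => norm_one_add_mul_I_le_exp (x t)

end Factor

/-! ## §2 The mean-one product of bounded martingale differences -/

section CLT

variable {Ω : Type*} [MeasurableSpace Ω] {P : Measure Ω} [IsProbabilityMeasure P] {D : ℕ → Ω → ℝ}

/-- The partial products `ω ↦ Π_{t<n} (1 + i a D_t ω)` are measurable. -/
theorem measurable_prod_one_add_mul_I (hDm : ∀ t, Measurable (D t)) (a : ℝ) (n : ℕ) :
    Measurable fun ω => ∏ t ∈ range n, ((1 : ℂ) + ((a * D t ω : ℝ) : ℂ) * I) := by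
  refine Finset.measurable_prod _ fun t _ => ?_
  exact measurable_const.add ((Complex.measurable_ofReal.comp ((hDm t).const_mul a)).mul_const I)

omit [MeasurableSpace Ω] in
/-- `‖Π_{t<n} (1 + i a D_t ω)‖ ≤ (1 + |a|·|C|)ⁿ` when `|D_t| ≤ C`. -/
theorem norm_prod_one_add_mul_I_le_pow (a : ℝ) {C : ℝ} (hC : ∀ t ω, |D t ω| ≤ C) (n : ℕ) (ω : Ω) :
    ‖∏ t ∈ range n, ((1 : ℂ) + ((a * D t ω : ℝ) : ℂ) * I)‖ ≤ (1 + |a| * |C|) ^ n := by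
  rw [norm_prod]
  calc ∏ t ∈ range n, ‖((1 : ℂ) + ((a * D t ω : ℝ) : ℂ) * I)‖ ≤ ∏ _t ∈ range n, (1 + |a| * |C|) := by
        refine Finset.prod_le_prod (fun t _ => norm_nonneg _) fun t _ => ?_
        calc _ ≤ 1 + |a * D t ω| := norm_one_add_mul_I_le _
          _ ≤ 1 + |a| * |C| := by
              rw [abs_mul]
              exact add_le_add le_rfl
                (mul_le_mul_of_nonneg_left ((hC t ω).trans (le_abs_self C)) (abs_nonneg a))
    _ = (1 + |a| * |C|) ^ n := by rw [Finset.prod_const, Finset.card_range]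

omit [MeasurableSpace Ω] in
/-- The clipping `s ↦ max (−C) (min C s)` is bounded by `|C|` (it fixes every `s` with `|s| ≤ C`:
`Literature.Analysis.FunctionSpaces.max_neg_min_eq_self`). -/
theorem abs_clip_le (C s : ℝ) : |max (-C) (min C s)| ≤ |C| := by
  rw [abs_le]
  constructor
  · exact (neg_le_neg (le_abs_self C)).trans (le_max_left _ _)
  · exact max_le (neg_le_abs C) ((min_le_left _ _).trans (le_abs_self C))

/-- **`E[Π_{t<n}(1 + i a D_t) · D_n] = 0`** under the orthogonality hypothesis: the real and
imaginary parts of the (clipped) product are bounded measurable functions of `(D_0, …, D_{n−1})`. -/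
theorem integral_prod_one_add_mul_I_mul_eq_zero (hDm : ∀ t, Measurable (D t)) {C : ℝ}
    (hC : ∀ t ω, |D t ω| ≤ C)
    (horth : ∀ (n : ℕ) (F : (Fin n → ℝ) → ℝ) (K : ℝ), Measurable F → (∀ v, |F v| ≤ K) →
      ∫ ω, F (fun i => D i ω) * D n ω ∂P = 0)
    (a : ℝ) (n : ℕ) :
    ∫ ω, (∏ t ∈ range n, ((1 : ℂ) + ((a * D t ω : ℝ) : ℂ) * I)) * (D n ω : ℂ) ∂P = 0 := by
  -- the clipped product as a continuous function on `Fin n → ℝ`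
  set G : (Fin n → ℝ) → ℂ :=
    fun v => ∏ i : Fin n, ((1 : ℂ) + ((a * max (-C) (min C (v i)) : ℝ) : ℂ) * I) with hG
  have hGc : Continuous G := by
    rw [hG]
    fun_prop
  have hGm : Measurable G := hGc.measurable
  have hGD : ∀ ω, G (fun i => D i ω) = ∏ t ∈ range n, ((1 : ℂ) + ((a * D t ω : ℝ) : ℂ) * I) := by
    intro ω
    rw [hG]
    dsimp only
    rw [← Fin.prod_univ_eq_prod_range]
    refine Finset.prod_congr rfl fun i _ => ?_
    rw [max_neg_min_eq_self (hC i ω)]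
  have hGK : ∀ v, ‖G v‖ ≤ (1 + |a| * |C|) ^ n := by
    intro v
    rw [hG]
    dsimp only
    rw [norm_prod]
    calc ∏ i : Fin n, ‖((1 : ℂ) + ((a * max (-C) (min C (v i)) : ℝ) : ℂ) * I)‖
        ≤ ∏ _i : Fin n, (1 + |a| * |C|) := by
          refine Finset.prod_le_prod (fun i _ => norm_nonneg _) fun i _ => ?_
          calc _ ≤ 1 + |a * max (-C) (min C (v i))| := norm_one_add_mul_I_le _
            _ ≤ 1 + |a| * |C| := by
                rw [abs_mul]
                exact add_le_add le_rfl
                  (mul_le_mul_of_nonneg_left (abs_clip_le C (v i)) (abs_nonneg a))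
      _ = (1 + |a| * |C|) ^ n := by simp
  -- the two real test functions
  have hre : ∫ ω, (fun v => (G v).re) (fun i => D i ω) * D n ω ∂P = 0 :=
    horth n (fun v => (G v).re) ((1 + |a| * |C|) ^ n) (Complex.measurable_re.comp hGm)
      (fun v => (Complex.abs_re_le_norm _).trans (hGK v))
  have him : ∫ ω, (fun v => (G v).im) (fun i => D i ω) * D n ω ∂P = 0 :=
    horth n (fun v => (G v).im) ((1 + |a| * |C|) ^ n) (Complex.measurable_im.comp hGm)
      (fun v => (Complex.abs_im_le_norm _).trans (hGK v))
  -- integrability of the complex product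
  have hZm := measurable_prod_one_add_mul_I hDm a n
  have hint : Integrable
      (fun ω => (∏ t ∈ range n, ((1 : ℂ) + ((a * D t ω : ℝ) : ℂ) * I)) * (D n ω : ℂ)) P := by
    refine Integrable.of_bound (hZm.mul (Complex.measurable_ofReal.comp (hDm n))).aestronglyMeasurable
      ((1 + |a| * |C|) ^ n * |C|) (ae_of_all _ fun ω => ?_)
    rw [norm_mul, Complex.norm_real, Real.norm_eq_abs]
    exact mul_le_mul (norm_prod_one_add_mul_I_le_pow a hC n ω) ((hC n ω).trans (le_abs_self C))
      (abs_nonneg _) (pow_nonneg (by positivity) _)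
  apply Complex.ext
  · have h := integral_re hint
    simp only [RCLike.re_to_complex] at h
    rw [Complex.zero_re, ← h]
    simp_rw [Complex.re_mul_ofReal]
    rw [← hre]
    refine integral_congr_ae (ae_of_all _ fun ω => ?_)
    simp only [hGD ω]
  · have h := integral_im hint
    simp only [RCLike.im_to_complex] at h
    rw [Complex.zero_im, ← h]
    simp_rw [Complex.im_mul_ofReal]
    rw [← him]
    refine integral_congr_ae (ae_of_all _ fun ω => ?_)
    simp only [hGD ω]

/-- **`E Π_{t<n}(1 + i a D_t) = 1`** (induction on `n`, one increment at a time). -/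
theorem integral_prod_one_add_mul_I_eq_one (hDm : ∀ t, Measurable (D t)) {C : ℝ}
    (hC : ∀ t ω, |D t ω| ≤ C)
    (horth : ∀ (n : ℕ) (F : (Fin n → ℝ) → ℝ) (K : ℝ), Measurable F → (∀ v, |F v| ≤ K) →
      ∫ ω, F (fun i => D i ω) * D n ω ∂P = 0)
    (a : ℝ) (n : ℕ) :
    ∫ ω, ∏ t ∈ range n, ((1 : ℂ) + ((a * D t ω : ℝ) : ℂ) * I) ∂P = 1 := by
  induction n with
  | zero => simp
  | succ n ih =>
    have hZm := measurable_prod_one_add_mul_I hDm a n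
    have hZint : Integrable (fun ω => ∏ t ∈ range n, ((1 : ℂ) + ((a * D t ω : ℝ) : ℂ) * I)) P :=
      Integrable.of_bound hZm.aestronglyMeasurable ((1 + |a| * |C|) ^ n)
        (ae_of_all _ (norm_prod_one_add_mul_I_le_pow a hC n))
    have hZDint : Integrable
        (fun ω => (∏ t ∈ range n, ((1 : ℂ) + ((a * D t ω : ℝ) : ℂ) * I)) * (D n ω : ℂ)) P := by
      refine Integrable.of_bound (hZm.mul (Complex.measurable_ofReal.comp (hDm n))).aestronglyMeasurable
        ((1 + |a| * |C|) ^ n * |C|) (ae_of_all _ fun ω => ?_)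
      rw [norm_mul, Complex.norm_real, Real.norm_eq_abs]
      exact mul_le_mul (norm_prod_one_add_mul_I_le_pow a hC n ω) ((hC n ω).trans (le_abs_self C))
        (abs_nonneg _) (pow_nonneg (by positivity) _)
    have hsplit : ∀ ω, (∏ t ∈ range (n + 1), ((1 : ℂ) + ((a * D t ω : ℝ) : ℂ) * I))
        = (∏ t ∈ range n, ((1 : ℂ) + ((a * D t ω : ℝ) : ℂ) * I))
          + (a * I) * ((∏ t ∈ range n, ((1 : ℂ) + ((a * D t ω : ℝ) : ℂ) * I)) * (D n ω : ℂ)) := by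
      intro ω
      rw [Finset.prod_range_succ]
      push_cast
      ring
    simp_rw [hsplit]
    rw [integral_add hZint (hZDint.const_mul _), integral_const_mul, ih,
      integral_prod_one_add_mul_I_mul_eq_zero hDm hC horth a n, mul_zero, add_zero]

end CLT

end Summit.Ventures.LatticeQCDFlow.Exactness.GeneralNCMC
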